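import Literature.Analysis.Calculus.AnalyticRootFunctionsReal
import Literature.Analysis.Calculus.MonomialUnits
import Literature.Algebra.Polynomial.ConjugatePairProducts
import Mathlib.Analysis.Analytic.Polynomial
import HarnessLib

/-!
# Jung's projection method: constant exponents of a monic divisor along the analytic roots

Continuation of `JungRootStructure.lean`. If `Rh(χ(σ), T) = ∏_l (T − ζ_l(σ))^{e_l}` on a box with
root functions `ζ_l` analytic on the box, pairwise distinct over the open cube and permuted by
conjugation through `τ`, then every monic divisor `Qh ∣ Rh` in `ℚ[x][T]` factors as
`Qh(χ(σ), T) = ∏_l (T − ζ_l(σ))^{k_l}` on the box with constant exponents `k_l ≤ e_l`, `k ∘ τ = k`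
(`exists_divisor_exponents`). Namespace `Literature.NumberTheory.Transcendental.JungPreparation`.

## References

* H. W. E. Jung, J. reine angew. Math. 133 (1908); J. Kollár, *Lectures on Resolution of
  Singularities* (2007), §2.3.
-/

noncomputable section

open Set Polynomial
open scoped ComplexConjugate
open Literature.Analysis.Calculus
open Literature.Algebra.Polynomial

namespace Literature.NumberTheory.Transcendental.JungPreparation

variable {d : ℕ}

/-- Root multiplicities of `∏_l (X − z_l)^{k_l}` for pairwise distinct `z_l`. [folklore] -/
theorem count_roots_prod_X_sub_C_pow {K : Type*} [CommRing K] [IsDomain K] [DecidableEq K] {n : ℕ}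
    {z : Fin n → K} (hz : Function.Injective z) (k : Fin n → ℕ) (l : Fin n) :
    (∏ l', (X - C (z l')) ^ k l').roots.count (z l) = k l := by
  classical
  rw [roots_prod_X_sub_C_pow, Multiset.count_sum']
  simp only [Multiset.count_nsmul, Multiset.count_singleton, hz.eq_iff]
  rw [Finset.sum_eq_single l (fun l' _ hl' => by simp [Ne.symm hl']) (by simp)]
  simp

/-- **Exponents of a monic divisor.** See the module docstring (Jung 1908; Kollár 2007, §2.3).
[folklore] -/
theorem exists_divisor_exponents {n : ℕ} {δ : ℝ} (hδ : 0 < δ)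
    {Rh Qh : (MvPolynomial (Fin d) ℚ)[X]} (hRh : Rh.Monic) (hQh : Qh.Monic) (hdvd : Qh ∣ Rh)
    (χ : (Fin d → ℝ) → (Fin d → ℝ))
    (hχa : AnalyticOnNhd ℝ χ (Set.pi Set.univ (fun _ : Fin d => Ioo (-δ) (1 + δ))))
    (ζ : Fin n → (Fin d → ℝ) → ℂ)
    (hζa : ∀ l, AnalyticOnNhd ℝ (ζ l) (Set.pi Set.univ (fun _ : Fin d => Ioo (-δ) (1 + δ))))
    (hinj : ∀ σ ∈ Set.pi Set.univ (fun _ : Fin d => Ioo (0 : ℝ) 1), Function.Injective fun l => ζ l σ)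
    {τ : Fin n → Fin n} (hτinv : Function.Involutive τ)
    (hτ : ∀ l, ∀ σ ∈ Set.pi Set.univ (fun _ : Fin d => Ioo (-δ) (1 + δ)), conj (ζ l σ) = ζ (τ l) σ)
    {e : Fin n → ℕ}
    (he : ∀ σ ∈ Set.pi Set.univ (fun _ : Fin d => Ioo (-δ) (1 + δ)),
      Rh.map ((algebraMap ℝ ℂ).comp (MvPolynomial.eval₂Hom (algebraMap ℚ ℝ) (χ σ))) =
        ∏ l, (X - C (ζ l σ)) ^ e l) :
    ∃ k : Fin n → ℕ,
      (∀ σ ∈ Set.pi Set.univ (fun _ : Fin d => Ioo (-δ) (1 + δ)),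
        Qh.map ((algebraMap ℝ ℂ).comp (MvPolynomial.eval₂Hom (algebraMap ℚ ℝ) (χ σ))) =
          ∏ l, (X - C (ζ l σ)) ^ k l) ∧
      (∀ l, k (τ l) = k l) ∧ (∀ l, k l ≤ e l) := by
  classical
  set Bx := Set.pi Set.univ (fun _ : Fin d => Ioo (-δ) (1 + δ)) with hBx
  set Ω := Set.pi Set.univ (fun _ : Fin d => Ioo (0 : ℝ) 1) with hΩ
  have hΩB : Ω ⊆ Bx := pi_Ioo_subset_box hδ
  have hΩo : IsOpen Ω := isOpen_set_pi finite_univ fun _ _ => isOpen_Ioo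
  set σ₀ : Fin d → ℝ := fun _ => 2⁻¹ with hσ₀
  have hσ₀Ω : σ₀ ∈ Ω := fun _ _ => ⟨by norm_num, by norm_num⟩
  have hΩne : Ω.Nonempty := ⟨σ₀, hσ₀Ω⟩
  have hBc : IsPreconnected Bx := isPreconnected_box _ _
  have hBo : IsOpen Bx := isOpen_set_pi finite_univ fun _ _ => isOpen_Ioo
  set evC : (Fin d → ℝ) → (MvPolynomial (Fin d) ℚ →+* ℂ) := fun x =>
    (algebraMap ℝ ℂ).comp (MvPolynomial.eval₂Hom (algebraMap ℚ ℝ) x) with hevC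
  -- roots of `Qh` are roots of `Rh`, hence among the `ζ_l`
  have hroots : ∀ σ ∈ Ω, ∀ t : ℂ, (Qh.map (evC (χ σ))).IsRoot t → ∃ l, t = ζ l σ := by
    intro σ hσ t ht
    have h := eval_eq_zero_of_dvd_of_eval_eq_zero (Polynomial.map_dvd (evC (χ σ)) hdvd) ht
    rw [he σ (hΩB hσ), eval_prod, Finset.prod_eq_zero_iff] at h
    obtain ⟨l, -, hl⟩ := h
    rw [eval_pow] at hl
    exact ⟨l, by simpa [sub_eq_zero] using (pow_eq_zero_iff'.1 hl).1⟩
  have hcoeff : ∀ j, AnalyticOnNhd ℝ (fun σ => (Qh.map (evC (χ σ))).coeff j) Bx := by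
    intro j σ hσ
    simp only [coeff_map, hevC, RingHom.comp_apply]
    refine (Complex.ofRealCLM.analyticAt _).comp ?_
    exact AnalyticAt.aeval_mvPolynomial (fun i => (analyticAt_pi_iff.1 (hχa σ hσ)) i) _
  obtain ⟨k, hk⟩ := exists_eq_prod_pow_of_roots_subset hBo hBc hΩB hΩo hΩne hζa Qh.natDegree
    (fun σ => Qh.map (evC (χ σ))) (fun σ _ => hQh.map _) (fun σ _ => hQh.natDegree_map _) hcoeff
    (fun σ hσ t ht => hroots σ hσ t ht)
  refine ⟨k, hk, ?_, fun l => ?_⟩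
  · refine exp_comp_perm_eq (hinj σ₀ hσ₀Ω) hτinv (fun l => (hτ l σ₀ (hΩB hσ₀Ω)).symm) ?_
    rw [← hk σ₀ (hΩB hσ₀Ω), hevC, ← Polynomial.map_map, Polynomial.map_map (algebraMap ℝ ℂ)]
    congr 1
    ext x
    simp
  · have hne : Rh.map (evC (χ σ₀)) ≠ 0 := (hRh.map _).ne_zero
    have hle := Polynomial.roots.le_of_dvd hne (Polynomial.map_dvd (evC (χ σ₀)) hdvd)
    have h := Multiset.count_le_of_le (ζ l σ₀) hle
    rwa [hk σ₀ (hΩB hσ₀Ω), he σ₀ (hΩB hσ₀Ω), count_roots_prod_X_sub_C_pow (hinj σ₀ hσ₀Ω),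
      count_roots_prod_X_sub_C_pow (hinj σ₀ hσ₀Ω)] at h

end Literature.NumberTheory.Transcendental.JungPreparation
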